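import Mathlib
import Literature.NumberTheory.Automorphic.InvariantOperatorEigenfunctions

/-!
# Unfolding over a fundamental domain and the projections of automorphic kernels
(Iwaniec, *Spectral Methods of Automorphic Forms*, GSM 53, §2.1–2.2 (discrete groups, fundamental
domains), PDF pp. 27–29; §7.4 (proof of Theorem 7.4), PDF p. 76)

Thirteenth layer of the `provefact` decomposition of `Literature.NumberTheory.Automorphic.sl2BallCount_asymp`
(`HyperbolicLatticeCount.lean`), fourth brick of the spectral theory of `L²(SL₂(ℤ)\\ℍ)` behind
`Iwaniec2002_thm_7_4_modular` (`ModularPretrace.lean`). Theorem 7.4 expands the automorphic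
kernel `K(z, w)`; "the projections of `K(z, w)` on the eigenfunctions are computed in
Theorem 1.16" (p. 76) — i.e. by *unfolding* the integral over the fundamental domain into an
integral over `ℍ` and applying Theorem 1.16 (`InvariantOperatorEigenfunctions.lean`). This file
proves the unfolding for the `Literature` notion `IsHypFundamentalDomain Γ F`
(`HyperbolicLaplaceSpectrum.lean`) of a discrete `Γ ≤ SL₂(ℝ)` (as matrices in `GL₂(ℝ)`, `-1 ∈ Γ`)
and the projection formula. Everything here is proved; nothing is vendored.

1. Discrete groups (`IsDiscreteSubgroup`) are countable; an element of `SL₂(ℝ)` other than `±1`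
   fixes at most one point of `ℍ`, so the elliptic points of `Γ` form a countable, hence null, set.
2. For a.e. `w ∈ ℍ` the matrices `γ ∈ Γ` with `γ w ∈ F` are exactly `±γ₀`
   (`ae_orbit_meets_two`: `covers` and `ae_unique` of `IsHypFundamentalDomain`, transported along
   the countable group by the invariance of the hyperbolic measure).
3. **Unfolding**: `Σ_{γ ∈ Γ} ∫_F φ(γ w) dμ(w) = ∫_F Σ_{γ ∈ Γ} φ(γ w) dμ(w) = 2 ∫_ℍ φ dμ` for
   `φ ≥ 0` measurable (Lebesgue integral) and for `φ ∈ L¹(ℍ)` (Bochner integral) — the translates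
   `γF` tile `ℍ` (§2.2), each tile counted twice over the matrices `±γ`.
4. `Σ_{γ ∈ Γ} k(u(γ z, w)) = Σ_{γ ∈ Γ} k(u(z, γ w)) = K(z, w)` (`automorphicKernel`,
   `AutomorphicKernel.lean`; hence `K(z, w) = K(w, z)` and `K(γ z, w) = K(z, w)`), so for `f`
   automorphic and locally integrable and a test kernel `k`:
   `∫_F K(z, w) f(w) dμ(w) = 2 (L_k f)(z)` (`setIntegral_automorphicKernel_mul`), and for an
   automorphic `C²` eigenfunction `(Δ + 1/4 + t²) f = 0`: **`∫_F K(z, w) f(w) dμ(w) = 2 h(t) f(z)`**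
   (`setIntegral_automorphicKernel_mul_eigenfunction`) — the projection formula of Theorem 7.4 in
   the matrix normalisation (factor `2`) of `ModularPretrace.lean`.

Mathlib: `SMulInvariantMeasure (GL (Fin 2) ℝ) ℍ volume`, `MeasureTheory.measurePreserving_smul`,
`MeasurePreserving.lintegral_comp_emb`/`integrable_comp_emb`, `MeasureTheory.integral_smul_eq_self`,
`lintegral_tsum`, `integral_tsum`, `MeasureTheory.measure_preimage_smul`. Mathlib's
`MeasureTheory.IsFundamentalDomain` (a.e.-disjoint translates) does not apply since `-1 ∈ Γ` acts
trivially (noted in `HyperbolicLaplaceSpectrum.lean`); no unfolding lemma for `ℍ` exists in Mathlib or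
Literature (`lean search 'unfold|IsHypFundamentalDomain'`).
-/

noncomputable section

namespace Literature.NumberTheory.Automorphic

open MeasureTheory Set Filter Real UpperHalfPlane
open scoped Topology MatrixGroups ENNReal

variable {Γ : Subgroup (GL (Fin 2) ℝ)} {F : Set ℍ}

/-! ## 1. Discrete groups are countable -/

/-- A discrete subgroup `Γ ≤ GL₂(ℝ)` (finitely many elements in each norm ball) is countable. [folklore] -/
theorem IsDiscreteSubgroup.countable (hd : IsDiscreteSubgroup Γ) : (Γ : Set (GL (Fin 2) ℝ)).Countable := by
  have hsub : (Γ : Set (GL (Fin 2) ℝ)) ⊆ ⋃ n : ℕ, {γ : GL (Fin 2) ℝ | γ ∈ Γ ∧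
      (γ 0 0 : ℝ) ^ 2 + (γ 0 1 : ℝ) ^ 2 + (γ 1 0 : ℝ) ^ 2 + (γ 1 1 : ℝ) ^ 2 ≤ n} := by
    intro γ hγ
    obtain ⟨n, hn⟩ := exists_nat_ge ((γ 0 0 : ℝ) ^ 2 + (γ 0 1 : ℝ) ^ 2 + (γ 1 0 : ℝ) ^ 2 + (γ 1 1 : ℝ) ^ 2)
    exact Set.mem_iUnion.mpr ⟨n, hγ, hn⟩
  exact (Set.countable_iUnion fun n : ℕ => (hd (n : ℝ)).countable).mono hsub

/-- A discrete subgroup is countable (as a subtype). [folklore] -/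
theorem IsDiscreteSubgroup.countable_coe (hd : IsDiscreteSubgroup Γ) :
    Countable {γ : GL (Fin 2) ℝ // γ ∈ Γ} :=
  hd.countable.to_subtype

/-! ## 2. Fixed points: a non-central element of `SL₂(ℝ)` fixes at most one point of `ℍ` -/

/-- If `γ ∈ GL₂⁺(ℝ)` fixes two distinct points of `ℍ` then `γ` is scalar: `c = 0`, `b = 0`, `a = d`.
(From `γ w = w`: `c w² + (d - a) w - b = 0`; two roots in `ℍ` force `c = 0`, `a = d`, `b = 0`.)
[folklore] -/
theorem GL_scalar_of_fixed_two {γ : GL (Fin 2) ℝ} (hdet : 0 < γ.det.val) {w₁ w₂ : ℍ} (hne : w₁ ≠ w₂)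
    (h₁ : γ • w₁ = w₁) (h₂ : γ • w₂ = w₂) :
    γ 1 0 = 0 ∧ γ 0 1 = 0 ∧ γ 0 0 = γ 1 1 := by
  -- the fixed point equations in ℂ
  have key : ∀ w : ℍ, γ • w = w →
      ((γ 1 0 : ℝ) : ℂ) * (w : ℂ) ^ 2 + (((γ 1 1 : ℝ) : ℂ) - ((γ 0 0 : ℝ) : ℂ)) * w - ((γ 0 1 : ℝ) : ℂ) = 0 := by
    intro w hw
    have hD : denom γ w ≠ 0 := denom_ne_zero γ w
    have e := congrArg (fun z : ℍ => (z : ℂ)) hw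
    simp only [coe_smul_of_det_pos hdet] at e
    rw [div_eq_iff hD] at e
    simp only [num, denom] at e
    linear_combination -e
  have e₁ := key w₁ h₁
  have e₂ := key w₂ h₂
  set a : ℝ := γ 0 0
  set b : ℝ := γ 0 1
  set c : ℝ := γ 1 0
  set d : ℝ := γ 1 1
  have hne' : (w₁ : ℂ) ≠ (w₂ : ℂ) := fun h => hne (UpperHalfPlane.ext h)
  -- subtract: (w₁ - w₂)(c(w₁ + w₂) + (d - a)) = 0
  have hsub : (c : ℂ) * ((w₁ : ℂ) + w₂) + ((d : ℂ) - a) = 0 := by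
    have h3 : ((w₁ : ℂ) - w₂) * ((c : ℂ) * ((w₁ : ℂ) + w₂) + ((d : ℂ) - a)) = 0 := by
      linear_combination e₁ - e₂
    exact (mul_eq_zero.mp h3).resolve_left (sub_ne_zero.mpr hne')
  -- imaginary parts: c (Im w₁ + Im w₂) = 0, so c = 0
  have hc : c = 0 := by
    have him := congrArg Complex.im hsub
    simp only [Complex.add_im, Complex.mul_im, Complex.ofReal_re, Complex.ofReal_im, zero_mul, add_zero,
      Complex.sub_im, Complex.zero_im, UpperHalfPlane.coe_im, sub_self] at him
    have hpos : 0 < w₁.im + w₂.im := add_pos w₁.im_pos w₂.im_pos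
    exact (mul_eq_zero.mp him).resolve_right hpos.ne'
  -- then d = a (real parts), b = 0
  have hda : d = a := by
    have hre := congrArg Complex.re hsub
    simp only [hc, Complex.ofReal_zero, zero_mul, zero_add, Complex.sub_re, Complex.ofReal_re,
      Complex.zero_re] at hre
    linarith
  have hb : b = 0 := by
    have h := e₁
    rw [hc, hda] at h
    simp only [Complex.ofReal_zero, zero_mul, zero_add, sub_self] at h
    have : ((b : ℝ) : ℂ) = 0 := by linear_combination -h
    exact_mod_cast this
  exact ⟨hc, hb, hda.symm⟩

/-- If `g ∈ SL₂(ℝ)` (inside `GL₂(ℝ)`) fixes two distinct points of `ℍ` then `g = ±1`. [folklore] -/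
theorem eq_one_or_neg_one_of_fixed_two {γ : GL (Fin 2) ℝ}
    (hγ : γ ∈ (Matrix.SpecialLinearGroup.toGL : SL(2, ℝ) →* GL (Fin 2) ℝ).range) {w₁ w₂ : ℍ}
    (hne : w₁ ≠ w₂) (h₁ : γ • w₁ = w₁) (h₂ : γ • w₂ = w₂) : γ = 1 ∨ γ = -1 := by
  obtain ⟨g, rfl⟩ := hγ
  have hdet : 0 < ((Matrix.SpecialLinearGroup.toGL g : GL (Fin 2) ℝ)).det.val := by simp
  obtain ⟨hc, hb, had⟩ := GL_scalar_of_fixed_two hdet hne h₁ h₂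
  have e : ∀ i j, ((Matrix.SpecialLinearGroup.toGL g : GL (Fin 2) ℝ)) i j = g i j := fun i j => rfl
  simp only [e] at hc hb had
  have hdet1 : g 0 0 * g 1 1 - g 0 1 * g 1 0 = 1 := by
    have := g.det_coe
    rw [Matrix.det_fin_two] at this
    linarith
  rw [hc, hb, ← had] at hdet1
  have ha : g 0 0 = 1 ∨ g 0 0 = -1 := mul_self_eq_one_iff.mp (by linarith)
  rcases ha with ha | ha
  · left
    ext i j
    rw [e]
    fin_cases i <;> fin_cases j <;> simp [ha, hb, hc, ← had]
  · right
    ext i j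
    rw [show ((-1 : GL (Fin 2) ℝ)) i j = -((1 : GL (Fin 2) ℝ) i j) from rfl, e]
    fin_cases i <;> fin_cases j <;> simp [ha, hb, hc, ← had]

/-- The set of elliptic points of `Γ`: points of `ℍ` fixed by some `γ ∈ Γ` other than `±1`. [cite: Iwaniec2002, §2.1–2.3, PDF pp. 27–30] -/
def ellipticPoints (Γ : Subgroup (GL (Fin 2) ℝ)) : Set ℍ :=
  {w : ℍ | ∃ γ ∈ Γ, γ • w = w ∧ γ ≠ 1 ∧ γ ≠ -1}

/-- For `Γ ≤ SL₂(ℝ)` the fixed point set in `ℍ` of `γ ∈ Γ`, `γ ≠ ±1`, has at most one point. [folklore] -/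
theorem subsingleton_fixedPoints (hΓ : Γ ≤ (Matrix.SpecialLinearGroup.toGL : SL(2, ℝ) →* GL (Fin 2) ℝ).range)
    {γ : GL (Fin 2) ℝ} (hγ : γ ∈ Γ) (h1 : γ ≠ 1) (h2 : γ ≠ -1) :
    ({w : ℍ | γ • w = w}).Subsingleton := by
  intro w₁ hw₁ w₂ hw₂
  by_contra hne
  rcases eq_one_or_neg_one_of_fixed_two (hΓ hγ) hne hw₁ hw₂ with hg | hg
  · exact h1 hg
  · exact h2 hg

/-- The elliptic points of a countable `Γ ≤ SL₂(ℝ)` form a countable set. [folklore] -/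
theorem countable_ellipticPoints (hΓ : Γ ≤ (Matrix.SpecialLinearGroup.toGL : SL(2, ℝ) →* GL (Fin 2) ℝ).range)
    (hc : (Γ : Set (GL (Fin 2) ℝ)).Countable) : (ellipticPoints Γ).Countable := by
  have hsub : ellipticPoints Γ ⊆ ⋃ γ ∈ {γ : GL (Fin 2) ℝ | γ ∈ Γ ∧ γ ≠ 1 ∧ γ ≠ -1}, {w : ℍ | γ • w = w} := by
    rintro w ⟨γ, hγ, hw, h1, h2⟩
    exact Set.mem_biUnion (x := γ) ⟨hγ, h1, h2⟩ hw
  refine Set.Countable.mono hsub (Set.Countable.biUnion (hc.mono fun γ hγ => hγ.1) ?_)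
  rintro γ ⟨hγ, h1, h2⟩
  exact (subsingleton_fixedPoints hΓ hγ h1 h2).countable

/-- Singletons are null for the hyperbolic measure. [folklore] -/
theorem volume_singleton_upperHalfPlane (w : ℍ) : (volume : Measure ℍ) {w} = 0 := by
  rw [UpperHalfPlane.volume_def, withDensity_apply _ (measurableSet_singleton w)]
  have h0 : (Measure.comap UpperHalfPlane.coe volume) {w} = 0 := by
    rw [measurableEmbedding_coe.comap_apply, Set.image_singleton]
    exact measure_singleton _
  rw [Measure.restrict_eq_zero.mpr h0, lintegral_zero_measure]

/-- Countable sets are null for the hyperbolic measure. [folklore] -/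
theorem measure_zero_of_countable {S : Set ℍ} (hS : S.Countable) : (volume : Measure ℍ) S = 0 := by
  rw [← Set.biUnion_of_singleton S]
  exact (measure_biUnion_null_iff hS).mpr fun w _ => volume_singleton_upperHalfPlane w

/-! ## 3. The stabiliser of a generic point is `{±1}` and a.e. uniqueness of representatives -/

/-- `-1 ∈ GL₂(ℝ)` acts trivially on `ℍ`. [folklore] -/
theorem neg_one_smul_upperHalfPlane (w : ℍ) : (-1 : GL (Fin 2) ℝ) • w = w := by
  rw [UpperHalfPlane.neg_smul, one_smul]

/-- `-γ` acts as `γ`. [folklore] -/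
theorem neg_smul_eq (γ : GL (Fin 2) ℝ) (w : ℍ) : (-γ) • w = γ • w := UpperHalfPlane.neg_smul γ w

/-- In `GL₂(ℝ)`, `γ ≠ -γ`. [folklore] -/
theorem ne_neg_self_GL (γ : GL (Fin 2) ℝ) : γ ≠ -γ := by
  intro h
  have h1 : ∀ i j, (γ : Matrix (Fin 2) (Fin 2) ℝ) i j = 0 := by
    intro i j
    have := congrArg (fun x : GL (Fin 2) ℝ => (x : Matrix (Fin 2) (Fin 2) ℝ) i j) h
    simp only [Units.val_neg, Matrix.neg_apply] at this
    linarith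
  have hdet := Matrix.GeneralLinearGroup.det_ne_zero γ
  apply hdet
  rw [show γ.val = (γ : Matrix (Fin 2) (Fin 2) ℝ) from rfl, Matrix.det_fin_two, h1, h1, h1, h1]
  ring

/-- Off the elliptic points the only elements of `Γ` fixing `w` are `±1`. [folklore] -/
theorem eq_one_or_neg_one_of_smul_eq {w : ℍ} (hw : w ∉ ellipticPoints Γ) {γ : GL (Fin 2) ℝ}
    (hγ : γ ∈ Γ) (h : γ • w = w) : γ = 1 ∨ γ = -1 := by
  by_contra hne
  rw [not_or] at hne
  exact hw ⟨γ, hγ, h, hne.1, hne.2⟩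

/-- The "bad" set where two inequivalent representatives of an orbit lie in `F`. [folklore] -/
theorem ae_unique_orbit (hc : (Γ : Set (GL (Fin 2) ℝ)).Countable) (hF : IsHypFundamentalDomain Γ F) :
    ∀ᵐ w : ℍ, ∀ γ ∈ Γ, ∀ γ' ∈ Γ, γ • w ∈ F → γ' • w ∈ F → γ • w = γ' • w := by
  -- the null set of `ae_unique` and its translates
  set N : Set ℍ := {z : ℍ | ¬ (z ∈ F → ∀ δ ∈ Γ, δ • z ∈ F → δ • z = z)} with hN
  have hN0 : volume N = 0 := by
    have := hF.ae_unique
    rw [ae_iff] at this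
    exact this
  have hbad : {w : ℍ | ¬ ∀ γ ∈ Γ, ∀ γ' ∈ Γ, γ • w ∈ F → γ' • w ∈ F → γ • w = γ' • w} ⊆
      ⋃ γ ∈ (Γ : Set (GL (Fin 2) ℝ)), (fun w : ℍ => γ • w) ⁻¹' N := by
    intro w hw
    simp only [Set.mem_setOf_eq, not_forall, exists_prop] at hw
    obtain ⟨γ, hγ, γ', hγ', h1, h2, hne⟩ := hw
    refine Set.mem_biUnion (x := γ) hγ ?_
    simp only [Set.mem_preimage, hN, Set.mem_setOf_eq, not_forall, exists_prop]
    refine ⟨h1, γ' * γ⁻¹, Γ.mul_mem hγ' (Γ.inv_mem hγ), ?_, ?_⟩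
    · rw [mul_smul, inv_smul_smul]; exact h2
    · rw [mul_smul, inv_smul_smul]; exact fun h => hne h.symm
  rw [ae_iff]
  refine measure_mono_null hbad ?_
  refine (measure_biUnion_null_iff hc).mpr fun γ _ => ?_
  rw [MeasureTheory.measure_preimage_smul]
  exact hN0

/-- **Generic orbits meet `F` in exactly the two matrices `±γ₀`**: for a.e. `w ∈ ℍ` (off the elliptic
points and the null set of `ae_unique`), the set `{γ ∈ Γ : γ w ∈ F}` is `{γ₀, -γ₀}` for some
`γ₀ ∈ Γ`. [cite: Iwaniec2002, §2.2 (fundamental domains; `F` and `γF` cover `ℍ`, disjoint interiors), PDF pp. 28–29] -/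
theorem ae_orbit_meets_two (hΓ : Γ ≤ (Matrix.SpecialLinearGroup.toGL : SL(2, ℝ) →* GL (Fin 2) ℝ).range)
    (hneg : (-1 : GL (Fin 2) ℝ) ∈ Γ) (hc : (Γ : Set (GL (Fin 2) ℝ)).Countable)
    (hF : IsHypFundamentalDomain Γ F) :
    ∀ᵐ w : ℍ, ∃ γ₀ ∈ Γ, γ₀ ≠ -γ₀ ∧ {γ : GL (Fin 2) ℝ | γ ∈ Γ ∧ γ • w ∈ F} = {γ₀, -γ₀} := by
  have hell : ∀ᵐ w : ℍ, w ∉ ellipticPoints Γ := by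
    rw [ae_iff]
    simp only [not_not, setOf_mem_eq]
    exact measure_zero_of_countable (countable_ellipticPoints hΓ hc)
  filter_upwards [hell, ae_unique_orbit hc hF] with w hw huniq
  obtain ⟨γ₀, hγ₀, hγ₀F⟩ := hF.covers w
  refine ⟨γ₀, hγ₀, ne_neg_self_GL γ₀, ?_⟩
  ext γ
  simp only [Set.mem_setOf_eq, Set.mem_insert_iff, Set.mem_singleton_iff]
  constructor
  · rintro ⟨hγ, hγF⟩
    have heq : γ • w = γ₀ • w := huniq γ hγ γ₀ hγ₀ hγF hγ₀F
    have hfix : (γ₀⁻¹ * γ) • w = w := by rw [mul_smul, heq, inv_smul_smul]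
    rcases eq_one_or_neg_one_of_smul_eq hw (Γ.mul_mem (Γ.inv_mem hγ₀) hγ) hfix with h | h
    · left; calc γ = γ₀ * (γ₀⁻¹ * γ) := by group
        _ = γ₀ := by rw [h, mul_one]
    · right; calc γ = γ₀ * (γ₀⁻¹ * γ) := by group
        _ = -γ₀ := by rw [h]; simp
  · rintro (rfl | rfl)
    · exact ⟨hγ₀, hγ₀F⟩
    · refine ⟨?_, ?_⟩
      · have : -γ₀ = (-1) * γ₀ := by simp
        rw [this]; exact Γ.mul_mem hneg hγ₀
      · rw [neg_smul_eq]; exact hγ₀F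


/-! ## 4. Unfolding: `Σ_γ ∫_F φ(γw) dμ = 2 ∫_ℍ φ dμ` -/

section Unfolding

variable (hΓ : Γ ≤ (Matrix.SpecialLinearGroup.toGL : SL(2, ℝ) →* GL (Fin 2) ℝ).range)
  (hneg : (-1 : GL (Fin 2) ℝ) ∈ Γ) (hc : (Γ : Set (GL (Fin 2) ℝ)).Countable) (hF : IsHypFundamentalDomain Γ F)
include hΓ hneg hc hF

/-- For a.e. `w`, the elements `γ ∈ Γ` with `γ⁻¹ w ∈ F` form a two-element set (`γ₀⁻¹` and
`-γ₀⁻¹`). [folklore] -/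
theorem ae_inv_smul_mem_iff_finset :
    ∀ᵐ w : ℍ, ∃ S : Finset Γ, S.card = 2 ∧ ∀ γ : Γ, ((γ : GL (Fin 2) ℝ)⁻¹ • w ∈ F ↔ γ ∈ S) := by
  filter_upwards [ae_orbit_meets_two hΓ hneg hc hF] with w hw
  obtain ⟨γ₀, hγ₀, hne, hset⟩ := hw
  have hγ₀' : γ₀⁻¹ ∈ Γ := Γ.inv_mem hγ₀
  have hnγ₀ : -γ₀ ∈ Γ := by
    have : -γ₀ = (-1) * γ₀ := by simp
    rw [this]; exact Γ.mul_mem hneg hγ₀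
  have hnγ₀' : (-γ₀)⁻¹ ∈ Γ := Γ.inv_mem hnγ₀
  set a : Γ := ⟨γ₀⁻¹, hγ₀'⟩
  set b : Γ := ⟨(-γ₀)⁻¹, hnγ₀'⟩
  have hab : a ≠ b := by
    intro h
    have : γ₀⁻¹ = (-γ₀)⁻¹ := congrArg Subtype.val h
    exact hne (inv_injective this)
  classical
  refine ⟨{a, b}, Finset.card_pair hab, fun γ => ?_⟩
  have h1 : ((γ : GL (Fin 2) ℝ)⁻¹ ∈ Γ ∧ (γ : GL (Fin 2) ℝ)⁻¹ • w ∈ F) ↔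
      ((γ : GL (Fin 2) ℝ)⁻¹ = γ₀ ∨ (γ : GL (Fin 2) ℝ)⁻¹ = -γ₀) := by
    have := Set.ext_iff.mp hset (γ : GL (Fin 2) ℝ)⁻¹
    simpa using this
  rw [Finset.mem_insert, Finset.mem_singleton]
  constructor
  · intro h
    rcases h1.mp ⟨Γ.inv_mem γ.2, h⟩ with h2 | h2
    · left; apply Subtype.ext; show (γ : GL (Fin 2) ℝ) = γ₀⁻¹; rw [← h2, inv_inv]
    · right; apply Subtype.ext; show (γ : GL (Fin 2) ℝ) = (-γ₀)⁻¹; rw [← h2, inv_inv]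
  · rintro (rfl | rfl)
    · exact (h1.mpr (Or.inl (by simp [a]))).2
    · exact (h1.mpr (Or.inr (by simp [b]))).2

/-- Consequently `Σ_{γ ∈ Γ} c · 𝟙_F(γ⁻¹ w) = 2c` a.e., in any additive commutative monoid. [folklore] -/
theorem ae_tsum_indicator_inv_smul {M : Type*} [AddCommMonoid M] [TopologicalSpace M] [T2Space M] (c : M) :
    ∀ᵐ w : ℍ, (∑' γ : Γ, F.indicator (fun _ => c) ((γ : GL (Fin 2) ℝ)⁻¹ • w)) = c + c := by
  filter_upwards [ae_inv_smul_mem_iff_finset hΓ hneg hc hF] with w hw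
  obtain ⟨S, hS2, hmem⟩ := hw
  have hsupp : ∀ γ : Γ, γ ∉ S → F.indicator (fun _ => c) ((γ : GL (Fin 2) ℝ)⁻¹ • w) = 0 := by
    intro γ hγ
    rw [Set.indicator_of_notMem]
    exact fun h => hγ ((hmem γ).mp h)
  rw [tsum_eq_sum hsupp]
  have e : ∀ γ ∈ S, F.indicator (fun _ => c) ((γ : GL (Fin 2) ℝ)⁻¹ • w) = c := fun γ hγ =>
    Set.indicator_of_mem ((hmem γ).mpr hγ) _
  rw [Finset.sum_congr rfl e, Finset.sum_const, hS2, two_nsmul]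

omit hΓ hneg hc in
/-- The change of variables `w ↦ γ⁻¹ w` in the hyperbolic measure:
`∫_F φ(γ w) dμ(w) = ∫_ℍ 𝟙_F(γ⁻¹ w) φ(w) dμ(w)` (Lebesgue integral). [folklore] -/
theorem setLIntegral_smul_eq (γ : GL (Fin 2) ℝ) (φ : ℍ → ℝ≥0∞) :
    ∫⁻ w in F, φ (γ • w) = ∫⁻ w, F.indicator (fun _ => (1 : ℝ≥0∞)) (γ⁻¹ • w) * φ w := by
  rw [← lintegral_indicator hF.measurableSet]
  have e : F.indicator (fun w => φ (γ • w)) =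
      fun w => F.indicator (fun _ => (1 : ℝ≥0∞)) (γ⁻¹ • (γ • w)) * φ (γ • w) := by
    funext w
    rw [inv_smul_smul]
    by_cases hw : w ∈ F
    · rw [Set.indicator_of_mem hw, Set.indicator_of_mem hw, one_mul]
    · rw [Set.indicator_of_notMem hw, Set.indicator_of_notMem hw, zero_mul]
  rw [e]
  exact (measurePreserving_smul γ (volume : Measure ℍ)).lintegral_comp_emb
    (MeasurableEquiv.smul γ).measurableEmbedding (fun v => F.indicator (fun _ => (1 : ℝ≥0∞)) (γ⁻¹ • v) * φ v)

omit hΓ hneg hc hF in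
/-- `w ↦ 𝟙_F(γ⁻¹ w)` is measurable. [folklore] -/
theorem measurable_indicator_inv_smul (hFm : MeasurableSet F) (γ : GL (Fin 2) ℝ) :
    Measurable fun w : ℍ => F.indicator (fun _ => (1 : ℝ≥0∞)) (γ⁻¹ • w) :=
  (measurable_const.indicator hFm).comp (measurable_const_smul γ⁻¹)

omit hΓ hneg hc hF in
/-- Translates of a.e.-measurable functions on `ℍ` are a.e.-measurable. [folklore] -/
theorem aemeasurable_comp_smul {φ : ℍ → ℝ≥0∞} (hφ : AEMeasurable φ) (γ : GL (Fin 2) ℝ) :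
    AEMeasurable fun w : ℍ => φ (γ • w) :=
  (measurePreserving_smul γ (volume : Measure ℍ)).aemeasurable_comp_iff
    (MeasurableEquiv.smul γ).measurableEmbedding |>.mpr hφ

/-- **Unfolding (Lebesgue integral)**: for a.e.-measurable `φ ≥ 0` on `ℍ`,
`Σ_{γ ∈ Γ} ∫_F φ(γ w) dμ(w) = 2 ∫_ℍ φ dμ` — the translates `γF`, `γ ∈ Γ/{±1}`, tile `ℍ` up to a
null set (Iwaniec §2.2), each counted twice over the matrices `±γ`. [cite: Iwaniec2002, §2.2, PDF pp. 28–29] -/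
theorem tsum_setLIntegral_smul_eq {φ : ℍ → ℝ≥0∞} (hφ : AEMeasurable φ) :
    ∑' γ : Γ, ∫⁻ w in F, φ ((γ : GL (Fin 2) ℝ) • w) = 2 * ∫⁻ w, φ w := by
  haveI : Countable Γ := hc.to_subtype
  simp_rw [setLIntegral_smul_eq hF]
  have hmeas : ∀ γ : Γ, AEMeasurable (fun w : ℍ => F.indicator (fun _ => (1 : ℝ≥0∞)) ((γ : GL (Fin 2) ℝ)⁻¹ • w) * φ w) volume :=
    fun γ => AEMeasurable.mul (measurable_indicator_inv_smul hF.measurableSet _).aemeasurable hφ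
  rw [← lintegral_tsum hmeas]
  simp_rw [ENNReal.tsum_mul_right]
  rw [← lintegral_const_mul' 2 _ (by norm_num)]
  refine lintegral_congr_ae ?_
  filter_upwards [ae_tsum_indicator_inv_smul hΓ hneg hc hF (1 : ℝ≥0∞)] with w hw
  rw [hw, one_add_one_eq_two]

/-- **Unfolding, swapped form**: `∫_F Σ_{γ ∈ Γ} φ(γ w) dμ(w) = 2 ∫_ℍ φ dμ`. [cite: Iwaniec2002, §2.2, PDF pp. 28–29] -/
theorem setLIntegral_tsum_smul_eq {φ : ℍ → ℝ≥0∞} (hφ : AEMeasurable φ) :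
    ∫⁻ w in F, ∑' γ : Γ, φ ((γ : GL (Fin 2) ℝ) • w) = 2 * ∫⁻ w, φ w := by
  haveI : Countable Γ := hc.to_subtype
  rw [lintegral_tsum fun γ => (aemeasurable_comp_smul hφ _).restrict]
  exact tsum_setLIntegral_smul_eq hΓ hneg hc hF hφ

/-! ## 5. Unfolding for integrable (complex-valued) functions -/

omit hΓ hneg hc in
/-- `∫_F φ(γ w) dμ(w) = ∫_ℍ 𝟙_F(γ⁻¹ w) φ(w) dμ(w)` (Bochner integral). [folklore] -/
theorem setIntegral_smul_eq (γ : GL (Fin 2) ℝ) (φ : ℍ → ℂ) :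
    ∫ w in F, φ (γ • w) = ∫ w, (F.indicator (fun _ => (1 : ℝ)) (γ⁻¹ • w)) • φ w := by
  rw [← integral_indicator hF.measurableSet]
  have e : F.indicator (fun w => φ (γ • w)) =
      fun w => (F.indicator (fun _ => (1 : ℝ)) (γ⁻¹ • (γ • w))) • φ (γ • w) := by
    funext w
    rw [inv_smul_smul]
    by_cases hw : w ∈ F
    · rw [Set.indicator_of_mem hw, Set.indicator_of_mem hw, one_smul]
    · rw [Set.indicator_of_notMem hw, Set.indicator_of_notMem hw, zero_smul]
  rw [e]
  have h := integral_smul_eq_self (μ := (volume : Measure ℍ))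
    (fun v => (F.indicator (fun _ => (1 : ℝ)) (γ⁻¹ • v)) • φ v) (g := γ)
  exact h

omit hΓ hneg hc hF in
/-- Translates of an integrable function are integrable. [folklore] -/
theorem integrable_comp_smul {φ : ℍ → ℂ} (hφ : Integrable φ) (γ : GL (Fin 2) ℝ) :
    Integrable (fun w => φ (γ • w)) :=
  (measurePreserving_smul γ (volume : Measure ℍ)).integrable_comp_emb
    (MeasurableEquiv.smul γ).measurableEmbedding |>.mpr hφ

/-- **Unfolding (Bochner integral)**: for `φ ∈ L¹(ℍ, dμ)`,
`Σ_{γ ∈ Γ} ∫_F φ(γ w) dμ(w) = 2 ∫_ℍ φ dμ`. [cite: Iwaniec2002, §2.2, PDF pp. 28–29] -/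
theorem tsum_setIntegral_smul_eq {φ : ℍ → ℂ} (hφ : Integrable φ) :
    ∑' γ : Γ, ∫ w in F, φ ((γ : GL (Fin 2) ℝ) • w) = 2 * ∫ w, φ w := by
  haveI : Countable Γ := hc.to_subtype
  set g : Γ → ℍ → ℂ := fun γ w => (F.indicator (fun _ => (1 : ℝ)) ((γ : GL (Fin 2) ℝ)⁻¹ • w)) • φ w with hg
  have hgm : ∀ γ, AEStronglyMeasurable (g γ) volume := fun γ => by
    have h1 : Measurable fun w : ℍ => F.indicator (fun _ => (1 : ℝ)) ((γ : GL (Fin 2) ℝ)⁻¹ • w) :=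
      (measurable_const.indicator hF.measurableSet).comp (measurable_const_smul ((γ : GL (Fin 2) ℝ)⁻¹))
    exact h1.aestronglyMeasurable.smul hφ.aestronglyMeasurable
  have hnorm : ∀ γ w, ‖g γ w‖ₑ = F.indicator (fun _ => (1 : ℝ≥0∞)) ((γ : GL (Fin 2) ℝ)⁻¹ • w) * ‖φ w‖ₑ := by
    intro γ w
    simp only [hg]
    by_cases h : (γ : GL (Fin 2) ℝ)⁻¹ • w ∈ F
    · rw [Set.indicator_of_mem h, Set.indicator_of_mem h, one_smul, one_mul]
    · rw [Set.indicator_of_notMem h, Set.indicator_of_notMem h, zero_smul, zero_mul, enorm_zero]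
  have hsum : ∑' γ, ∫⁻ w, ‖g γ w‖ₑ ≠ ∞ := by
    simp_rw [hnorm]
    have e2 : ∀ γ : Γ, ∫⁻ w, F.indicator (fun _ => (1 : ℝ≥0∞)) ((γ : GL (Fin 2) ℝ)⁻¹ • w) * ‖φ w‖ₑ =
        ∫⁻ w in F, ‖φ ((γ : GL (Fin 2) ℝ) • w)‖ₑ :=
      fun γ => (setLIntegral_smul_eq hF (γ : GL (Fin 2) ℝ) (fun w => ‖φ w‖ₑ)).symm
    simp_rw [e2]
    have h' : ∑' γ : Γ, ∫⁻ w in F, ‖φ ((γ : GL (Fin 2) ℝ) • w)‖ₑ = 2 * ∫⁻ w, ‖φ w‖ₑ :=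
      tsum_setLIntegral_smul_eq hΓ hneg hc hF (φ := fun w => ‖φ w‖ₑ) hφ.aestronglyMeasurable.aemeasurable.enorm
    rw [h']
    exact ENNReal.mul_ne_top (by norm_num) hφ.hasFiniteIntegral.ne
  have key := integral_tsum hgm hsum
  -- ∫ Σ_γ g_γ = ∫ 2 φ
  have hleft : ∫ w, ∑' γ, g γ w = 2 * ∫ w, φ w := by
    rw [← integral_const_mul]
    refine integral_congr_ae ?_
    filter_upwards [ae_inv_smul_mem_iff_finset hΓ hneg hc hF] with w hw
    obtain ⟨S, hS2, hmem⟩ := hw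
    have hsupp : ∀ γ : Γ, γ ∉ S → g γ w = 0 := by
      intro γ hγ
      simp only [hg]
      rw [Set.indicator_of_notMem (fun h => hγ ((hmem γ).mp h)), zero_smul]
    rw [tsum_eq_sum hsupp]
    have e : ∀ γ ∈ S, g γ w = φ w := fun γ hγ => by
      simp only [hg]; rw [Set.indicator_of_mem ((hmem γ).mpr hγ), one_smul]
    rw [Finset.sum_congr rfl e, Finset.sum_const, hS2, two_nsmul]
    ring
  -- Σ_γ ∫ g_γ = Σ_γ ∫_F φ(γ ·)
  have hright : ∑' γ, ∫ w, g γ w = ∑' γ : Γ, ∫ w in F, φ ((γ : GL (Fin 2) ℝ) • w) := by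
    congr 1 with γ
    exact (setIntegral_smul_eq hF _ φ).symm
  rw [← hright, ← key, hleft]

/-- **Unfolding (Bochner, swapped form)**: `∫_F Σ_{γ ∈ Γ} φ(γ w) dμ(w) = 2 ∫_ℍ φ dμ` for
`φ ∈ L¹(ℍ)`, the series converging absolutely a.e. on `F`. [cite: Iwaniec2002, §2.2, PDF pp. 28–29] -/
theorem setIntegral_tsum_smul_eq {φ : ℍ → ℂ} (hφ : Integrable φ) :
    ∫ w in F, ∑' γ : Γ, φ ((γ : GL (Fin 2) ℝ) • w) = 2 * ∫ w, φ w := by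
  haveI : Countable Γ := hc.to_subtype
  have hgm : ∀ γ : Γ, AEStronglyMeasurable (fun w => φ ((γ : GL (Fin 2) ℝ) • w)) (volume.restrict F) :=
    fun γ => (integrable_comp_smul hφ _).aestronglyMeasurable.restrict
  have hsum : ∑' γ : Γ, ∫⁻ w in F, ‖φ ((γ : GL (Fin 2) ℝ) • w)‖ₑ ≠ ∞ := by
    have h' : ∑' γ : Γ, ∫⁻ w in F, ‖φ ((γ : GL (Fin 2) ℝ) • w)‖ₑ = 2 * ∫⁻ w, ‖φ w‖ₑ :=
      tsum_setLIntegral_smul_eq hΓ hneg hc hF (φ := fun w => ‖φ w‖ₑ) hφ.aestronglyMeasurable.aemeasurable.enorm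
    rw [h']
    exact ENNReal.mul_ne_top (by norm_num) hφ.hasFiniteIntegral.ne
  rw [integral_tsum hgm hsum]
  exact tsum_setIntegral_smul_eq hΓ hneg hc hF hφ

end Unfolding

open scoped ComplexConjugate

/-! ## 6. Unfolding of invariant integral operators: `2 (L_k f)(z) = ∫_F K(z, w) f(w) dμ(w)` -/

section KernelUnfolding

variable {Γ : Subgroup (GL (Fin 2) ℝ)} {F : Set ℍ} {k : ℝ → ℝ}

/-- `u(z, γ w) = u(γ⁻¹ z, w)` for `γ` in the image of `SL₂(ℝ)`. [folklore] -/
theorem pointPairInv_smul_right {γ : GL (Fin 2) ℝ}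
    (hγ : γ ∈ (Matrix.SpecialLinearGroup.toGL : SL(2, ℝ) →* GL (Fin 2) ℝ).range) (z w : ℍ) :
    pointPairInv z (γ • w) = pointPairInv (γ⁻¹ • z) w := by
  obtain ⟨g, rfl⟩ := hγ
  have e : ∀ x : ℍ, (Matrix.SpecialLinearGroup.toGL g : GL (Fin 2) ℝ) • x = g • x := fun x => rfl
  have e' : ∀ x : ℍ, (Matrix.SpecialLinearGroup.toGL g : GL (Fin 2) ℝ)⁻¹ • x = g⁻¹ • x := fun x => by
    rw [← map_inv]; rfl
  rw [e, e']
  conv_lhs => rw [show z = g • (g⁻¹ • z) by rw [smul_inv_smul]]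
  exact pointPairInv_smul g (g⁻¹ • z) w

/-- The automorphic kernel as a sum over the countable group (matrices `γ ∈ Γ`):
`Σ_{γ ∈ Γ} k(u(γ z, w)) = K(z, w)`, for a kernel vanishing beyond `M` and discrete `Γ ≤ SL₂(ℝ)`
(the `finsum` of `automorphicKernel` as a `tsum`). [cite: Iwaniec2002, §7.4, PDF p. 76] -/
theorem tsum_kernel_eq_automorphicKernel
    (hΓ : Γ ≤ (Matrix.SpecialLinearGroup.toGL : SL(2, ℝ) →* GL (Fin 2) ℝ).range)
    (hd : IsDiscreteSubgroup Γ) {M : ℝ} (hM : ∀ u, M ≤ u → k u = 0) (z w : ℍ) :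
    ∑' γ : Γ, k (pointPairInv ((γ : GL (Fin 2) ℝ) • z) w) = automorphicKernel Γ k z w := by
  have hfin := finite_hypBall hΓ hd z w M
  rw [automorphicKernel_eq_sum hM z w hfin (fun γ hγ => hγ.1) (fun γ hγ hlt => ⟨hγ, hlt.le⟩)]
  classical
  have hsupp : ∀ γ : Γ, γ ∉ (hfin.toFinset.subtype (· ∈ Γ)) → k (pointPairInv ((γ : GL (Fin 2) ℝ) • z) w) = 0 := by
    intro γ hγ
    apply hM
    by_contra hlt
    apply hγ
    simp only [Finset.mem_subtype, Set.Finite.mem_toFinset]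
    exact ⟨γ.2, (not_le.mp hlt).le⟩
  rw [tsum_eq_sum hsupp]
  rw [Finset.sum_subtype_eq_sum_filter (f := fun γ : GL (Fin 2) ℝ => k (pointPairInv (γ • z) w))]
  rw [Finset.filter_true_of_mem]
  intro γ hγ
  exact ((Set.Finite.mem_toFinset hfin).mp hγ).1

/-- The same summed over the second argument: `Σ_{γ ∈ Γ} k(u(z, γ w)) = K(z, w)` (reindexing
`γ ↦ γ⁻¹`, `u(z, γ w) = u(γ⁻¹ z, w)`). [cite: Iwaniec2002, §7.4, PDF p. 76] -/
theorem tsum_kernel_smul_eq_automorphicKernel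
    (hΓ : Γ ≤ (Matrix.SpecialLinearGroup.toGL : SL(2, ℝ) →* GL (Fin 2) ℝ).range)
    (hd : IsDiscreteSubgroup Γ) {M : ℝ} (hM : ∀ u, M ≤ u → k u = 0) (z w : ℍ) :
    ∑' γ : Γ, k (pointPairInv z ((γ : GL (Fin 2) ℝ) • w)) = automorphicKernel Γ k z w := by
  rw [← tsum_kernel_eq_automorphicKernel hΓ hd hM z w, ← (Equiv.inv Γ).tsum_eq]
  congr 1 with γ
  simp only [Equiv.inv_apply, Subgroup.coe_inv]
  rw [pointPairInv_smul_right (hΓ (Γ.inv_mem γ.2)), inv_inv]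

/-- **Symmetry of the automorphic kernel**: `K(z, w) = K(w, z)` for discrete `Γ ≤ SL₂(ℝ)` and a
compactly supported kernel. [folklore] -/
theorem automorphicKernel_comm
    (hΓ : Γ ≤ (Matrix.SpecialLinearGroup.toGL : SL(2, ℝ) →* GL (Fin 2) ℝ).range)
    (hd : IsDiscreteSubgroup Γ) {M : ℝ} (hM : ∀ u, M ≤ u → k u = 0) (z w : ℍ) :
    automorphicKernel Γ k z w = automorphicKernel Γ k w z := by
  rw [← tsum_kernel_smul_eq_automorphicKernel hΓ hd hM z w, ← tsum_kernel_eq_automorphicKernel hΓ hd hM w z]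
  congr 1 with γ
  rw [pointPairInv_comm]

/-- The automorphic kernel is automorphic in the first variable: `K(γ z, w) = K(z, w)`. [folklore] -/
theorem automorphicKernel_smul_left
    (hΓ : Γ ≤ (Matrix.SpecialLinearGroup.toGL : SL(2, ℝ) →* GL (Fin 2) ℝ).range)
    (hd : IsDiscreteSubgroup Γ) {M : ℝ} (hM : ∀ u, M ≤ u → k u = 0) {γ₀ : GL (Fin 2) ℝ} (hγ₀ : γ₀ ∈ Γ)
    (z w : ℍ) : automorphicKernel Γ k (γ₀ • z) w = automorphicKernel Γ k z w := by
  rw [← tsum_kernel_eq_automorphicKernel hΓ hd hM, ← tsum_kernel_eq_automorphicKernel hΓ hd hM z w]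
  simp_rw [← mul_smul]
  exact (Equiv.mulRight (⟨γ₀, hγ₀⟩ : Γ)).tsum_eq (fun γ : Γ => k (pointPairInv ((γ : GL (Fin 2) ℝ) • z) w))

variable (hΓ : Γ ≤ (Matrix.SpecialLinearGroup.toGL : SL(2, ℝ) →* GL (Fin 2) ℝ).range)
  (hneg : (-1 : GL (Fin 2) ℝ) ∈ Γ) (hd : IsDiscreteSubgroup Γ) (hF : IsHypFundamentalDomain Γ F)
include hΓ hneg hd hF

/-- **Unfolding an invariant integral operator over a fundamental domain**: for `f` automorphic
and locally integrable and a test kernel `k`,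
`2 ∫_ℍ k(u(z, w)) f(w) dμ(w) = ∫_F K(z, w) f(w) dμ(w)` with `K(z, w) = Σ_{γ ∈ Γ} k(u(γz, w))` the
automorphic kernel over matrices (the factor `2 = #{±1}`; Iwaniec, §7.4 and the proof of Thm 1.16 /
(7.17): "The projections of `K(z, w)` on the eigenfunctions are computed in Theorem 1.16").
[cite: Iwaniec2002, §7.4, PDF p. 76] -/
theorem setIntegral_automorphicKernel_mul (hk : IsTestKernel k) {f : ℍ → ℂ} (hfa : IsAutomorphic Γ f)
    (hfi : LocallyIntegrable f) (z : ℍ) :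
    ∫ w in F, (automorphicKernel Γ k z w : ℂ) * f w = 2 * invariantOperator k f z := by
  obtain ⟨hkm, ⟨B, hB⟩, ⟨M, hM0, hM⟩⟩ := id hk
  have hφ : Integrable fun w : ℍ => (k (pointPairInv z w) : ℂ) * f w := integrable_kernel_mul hk hfi z
  have h := setIntegral_tsum_smul_eq hΓ hneg hd.countable hF hφ
  unfold invariantOperator
  rw [← h]
  refine setIntegral_congr_fun hF.measurableSet fun w _ => ?_
  have e : ∀ γ : Γ, f ((γ : GL (Fin 2) ℝ) • w) = f w := fun γ => hfa γ γ.2 w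
  simp only [e]
  rw [tsum_mul_right, ← Complex.ofReal_tsum, tsum_kernel_smul_eq_automorphicKernel hΓ hd hM z w]

/-- **The projection formula of Theorem 7.4** (Iwaniec p. 76: `⟨K(·, w), u_j⟩ = h(t_j) ū_j(w)`,
computed by Theorem 1.16), in the form: for an automorphic `C²` eigenfunction `f`,
`(Δ + 1/4 + t²) f = 0`, and a test kernel `k`,
`∫_F K(z, w) f(w) dμ(w) = 2 h(t) f(z)` (matrix normalisation, factor `2`).
[cite: Iwaniec2002, Thm 7.4 (proof) & Thm 1.16, PDF pp. 76, 24] -/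
theorem setIntegral_automorphicKernel_mul_eigenfunction (hk : IsTestKernel k) {f : ℍ → ℂ}
    (hfa : IsAutomorphic Γ f) (hf : IsC2 f) (t : ℂ) (heig : ∀ z, hypLaplacian f z + (1 / 4 + t ^ 2) * f z = 0)
    (z : ℍ) :
    ∫ w in F, (automorphicKernel Γ k z w : ℂ) * f w = 2 * selbergTransform k t * f z := by
  rw [setIntegral_automorphicKernel_mul hΓ hneg hd hF hk hfa hf.continuous.locallyIntegrable z,
    invariantOperator_eigenfunction hk hf t heig z, mul_assoc]

end KernelUnfolding

end Literature.NumberTheory.Automorphic
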